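import Summits.AtomisticToContinuum.Crystallization.Theorems.FrustratedLawDichotomyDRowsA15KernelX
import Summits.AtomisticToContinuum.Crystallization.Theorems.FrustratedLawDichotomyDRowsA15KernelY

/-!
# DROWS-SOUND for the A15 chunk, closed: the two perfect-template root-energy floors with the transfer

decomp-a2c hand-2 g46 — structural share for `AperiodicFrustratedLawGap` (stmt-27623), class-D rows (critic r1757 (C)(b) «DROWS-SOUND»).
Composition for the A15 template of `…DRowsA15Template` (rooted at a class-X site `rX = (0,0,0)` or a class-Y site `rY = (1,0,2)`, NN distance `s`):
`window_floor` — for ANY root `r` with coordinates in `[0,3]` and ANY histogram `H` satisfying COVER/FIBRES/NODUP on `a15Box r`, the booked window sum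
read at scale `s` minus the envelope is below `2·rootEnergy` (#67 assembly ∘ #68 regrouping ∘ #72 separation/far bound); then with the kernel facts of
`…DRowsA15KernelX/Y` and the K reading `…DRowsA15Sound.drows_A15_sound` (transfer rule included):

★★★ `a15_rootEnergy_floors` — for every leaf `i < 128` and every `s ∈ [sNum i/sDen, sNum (i+1)/sDen]` (`s/s⋆ ∈ [0.94, 1.06]`, `s⋆ = 0.88753`) there is a
transfer `t ≥ 0` with  `e⋆ + 27/1000 − 12·t ≤ rootEnergy V_LJ (count⌊a15Template rX s)`  and  `e⋆ + 27/1000 + 4·t ≤ rootEnergy V_LJ (count⌊a15Template rY s)`.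
(Each class-Y site pays `t` to each of its 4 class-X neighbours' … — the bookkeeping of census's transfer rule; the law-level transport is lens-5's row design.)
DEF-FREE.
-/

namespace Summit.AtomisticToContinuum.Crystallization.Theorems.FrustratedLawDichotomyDRowsA15Floor

open MeasureTheory Metric Set
open scoped BigOperators
open Literature.MathematicalPhysics.StatisticalMechanics (lennardJones rootEnergy)
open Literature.Barriers.AtomisticToContinuum (scaledIntPoint scaledIntPoint_apply norm_scaledIntPoint_sq scaledIntPoint_injective
  scaledIntPoint_zero)
open Summit.AtomisticToContinuum.Crystallization.Theorems.ChargedEnergyGapNegative (E3 eStar)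
open Summit.AtomisticToContinuum.Crystallization.Theorems.FrustratedLawDichotomyDRowsA15 (H0 H1 sNum sDen xnum XD)
open Summit.AtomisticToContinuum.Crystallization.Theorems.FrustratedLawDichotomyCoherentFloorAlgebra (phiT)
open Summit.AtomisticToContinuum.Crystallization.Theorems.FrustratedLawDichotomyDRowsA15Sound (drows_A15_sound)
open Summit.AtomisticToContinuum.Crystallization.Theorems.FrustratedLawDichotomyDRowsAssembly (sum_phiT_sub_env_le_two_mul_rootEnergy)
open Summit.AtomisticToContinuum.Crystallization.Theorems.FrustratedLawDichotomyDRowsRegroup (sum_key_eq_histogram)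
open Summit.AtomisticToContinuum.Crystallization.Theorems.FrustratedLawDichotomyDRowsBccTemplate
  (toVec nsq toVec_zero toVec_one toVec_two toVec_injective toVec_triple toVec_zero' norm_sq_toVec nsq_nonneg)
open Summit.AtomisticToContinuum.Crystallization.Theorems.FrustratedLawDichotomyDRowsA15Template
  (inFrame a15Template a15Box a15Win a15Template_separated zero_mem_a15Template nsq_lt_of_inside_A15 far_of_not_mem_a15Win)
open Summit.AtomisticToContinuum.Crystallization.Theorems.FrustratedLawDichotomyDRowsA15Frame (rX rY nodup_H1_A15)
open Summit.AtomisticToContinuum.Crystallization.Theorems.FrustratedLawDichotomyDRowsA15KernelX (fibres_X cover_X)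
open Summit.AtomisticToContinuum.Crystallization.Theorems.FrustratedLawDichotomyDRowsA15KernelY (fibres_Y cover_Y)

/-! ## §1 A15 scale-window arithmetic (file-local) -/

/-- the A15 scale denominator is positive (file-local). -/
private theorem sDen_pos : 0 < sDen := by unfold sDen XD; decide

/-- the A15 leaf ends are positive (file-local). -/
private theorem sNum_pos (i : ℕ) : 0 < sNum i := by unfold sNum xnum; omega

/-- consecutive A15 leaf ends are within a factor `10`. -/
private theorem sNum_succ_le (i : ℕ) : sNum (i + 1) ≤ 10 * sNum i := by unfold sNum xnum; omega

/-- A15 leaf ends are below `20·sDen`. -/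
private theorem sNum_le (i : ℕ) (hi : i < 200) : sNum (i + 1) ≤ 20 * sDen := by unfold sNum xnum sDen XD; omega

/-- the shells of the A15 `H0` are pairwise distinct (file-local: printed statement coincides with the bcc twin). -/
private theorem nodup_H0 : (H0.map Prod.fst).Nodup := by decide +kernel

/-! ## §2 The window floor for any root and any certified histogram -/

/-- ★ for a root `r` of the frame and a histogram `H` with NODUP/COVER/FIBRES on `a15Box r`: at every scale `s ≥ sNum i/sDen` (leaf `i < 128`),
`Σ_{(D,m) ∈ H, inside_i D} m·φ(s²D/4) − (1/6)·Env₆(δ_i, R_i) ≤ 2·rootEnergy V_LJ (count⌊a15Template r s)`. -/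
theorem window_floor {r : ℤ × ℤ × ℤ} (hrf : inFrame r = true) {H : List (ℕ × ℕ)} (hnd : (H.map Prod.fst).Nodup)
    (hcov : ∀ v ∈ a15Box r, nsq v < 575 → (nsq v).toNat ∈ H.map Prod.fst)
    (hfib : ∀ Dm ∈ H, ((a15Box r).filter fun v => nsq v = (Dm.1 : ℤ)).card = Dm.2)
    {i : ℕ} (hi : i < 128) {s : ℝ} (hs1 : (sNum i : ℝ) / sDen ≤ s) :
    (H.map fun Dm : ℕ × ℕ =>
        if sNum (i + 1) * sNum (i + 1) * (Dm.1 : ℤ) < 100 * (4 * sDen * sDen) then (Dm.2 : ℝ) * phiT (s ^ 2 * Dm.1 / 4) else 0).sum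
      - 1 / 6 * ((2 / ((sNum i : ℝ) / sDen)) ^ 3 * (10 * (sNum i : ℝ) / sNum (i + 1))⁻¹ ^ 3
        + 15 / 2 * (2 / ((sNum i : ℝ) / sDen)) ^ 2 * (10 * (sNum i : ℝ) / sNum (i + 1))⁻¹ ^ 4
        + 3 / 5 * (2 / ((sNum i : ℝ) / sDen)) * (10 * (sNum i : ℝ) / sNum (i + 1))⁻¹ ^ 5 + 2 * (10 * (sNum i : ℝ) / sNum (i + 1))⁻¹ ^ 6) ≤
      2 * rootEnergy lennardJones (Measure.count.restrict (a15Template r s) : Measure E3) := by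
  classical
  have hDpos : (0 : ℝ) < sDen := by exact_mod_cast sDen_pos
  have hlo : (0 : ℝ) < sNum i := by exact_mod_cast sNum_pos i
  have hhi : (0 : ℝ) < sNum (i + 1) := by exact_mod_cast sNum_pos (i + 1)
  have hδ0 : (0 : ℝ) < (sNum i : ℝ) / sDen := div_pos hlo hDpos
  have hs0 : 0 < s := hδ0.trans_le hs1
  have ht0 : 0 < s / 2 := by linarith
  have ht2 : (s / 2) ^ 2 = s ^ 2 / 4 := by ring
  have h10 : (sNum (i + 1) : ℝ) ≤ 10 * sNum i := by
    have := (Int.cast_le (R := ℝ)).mpr (sNum_succ_le i); push_cast at this; exact this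
  have h20 : (sNum (i + 1) : ℝ) ≤ 20 * sDen := by
    have := (Int.cast_le (R := ℝ)).mpr (sNum_le i (by omega)); push_cast at this; exact this
  have hR1 : (1 : ℝ) ≤ 10 * (sNum i : ℝ) / sNum (i + 1) := by rw [le_div_iff₀ hhi]; linarith
  have hR0 : (0 : ℝ) ≤ 10 * (sNum i : ℝ) / sNum (i + 1) := zero_le_one.trans hR1
  have hRδ : (sNum i : ℝ) / sDen / 2 ≤ 10 * (sNum i : ℝ) / sNum (i + 1) := by
    rw [div_div, div_le_div_iff₀ (mul_pos hDpos two_pos) hhi]; nlinarith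
  have hfinj : Function.Injective fun m : ℤ × ℤ × ℤ => scaledIntPoint (s / 2) (toVec m) :=
    fun m m' h => toVec_injective (scaledIntPoint_injective ht0.ne' h)
  have hsep : ∀ p ∈ a15Template r s, ∀ p' ∈ a15Template r s, p ≠ p' → (sNum i : ℝ) / sDen ≤ dist p p' :=
    fun p hp p' hp' hne => hs1.trans (a15Template_separated r hs0 p hp p' hp' hne)
  have hWS : (↑((a15Win r i).image fun m => scaledIntPoint (s / 2) (toVec m)) : Set E3) ⊆ a15Template r s := by
    intro z hz
    obtain ⟨m, hm, rfl⟩ := Finset.mem_image.mp (Finset.mem_coe.mp hz)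
    have hm' := (Finset.mem_filter.mp (Finset.mem_filter.mp hm).1).2.1
    exact ⟨toVec m, by simpa using hm', rfl⟩
  have h0W : (0 : E3) ∉ (a15Win r i).image fun m => scaledIntPoint (s / 2) (toVec m) := by
    intro h0
    obtain ⟨m, hm, hm0⟩ := Finset.mem_image.mp h0
    have hmne := (Finset.mem_filter.mp (Finset.mem_filter.mp hm).1).2.2
    apply hmne
    apply toVec_injective
    rw [toVec_zero']
    apply scaledIntPoint_injective ht0.ne'
    rw [hm0, scaledIntPoint_zero]
  have hfar : ∀ z ∈ a15Template r s, z ∉ ((a15Win r i).image fun m => scaledIntPoint (s / 2) (toVec m)) → z ≠ 0 →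
      10 * (sNum i : ℝ) / sNum (i + 1) ≤ ‖z‖ := by
    rintro z ⟨v, hv, rfl⟩ hzW hz0
    have hvm : toVec (v 0, v 1, v 2) = v := toVec_triple v
    have hfr : inFrame ((v 0, v 1, v 2).1 + r.1, (v 0, v 1, v 2).2.1 + r.2.1, (v 0, v 1, v 2).2.2 + r.2.2) = true := hv
    have hm0 : (v 0, v 1, v 2) ≠ (0 : ℤ × ℤ × ℤ) := by
      intro h
      apply hz0
      have : v = 0 := by rw [← hvm, h, toVec_zero']
      rw [this, scaledIntPoint_zero]
    have hmW : (v 0, v 1, v 2) ∉ a15Win r i := by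
      intro h
      apply hzW
      rw [Finset.mem_image]
      refine ⟨(v 0, v 1, v 2), h, ?_⟩
      show scaledIntPoint (s / 2) (toVec (v 0, v 1, v 2)) = scaledIntPoint (s / 2) v
      rw [hvm]
    have hfarZ := far_of_not_mem_a15Win hfr hm0 hmW
    have hfarR : (100 : ℝ) * (4 * (sDen : ℝ) * sDen) ≤ (sNum (i + 1) : ℝ) * sNum (i + 1) * (nsq (v 0, v 1, v 2) : ℝ) := by
      have := (Int.cast_le (R := ℝ)).mpr hfarZ; push_cast at this; exact this
    have hnsq : ‖scaledIntPoint (s / 2) v‖ ^ 2 = (s / 2) ^ 2 * (nsq (v 0, v 1, v 2) : ℝ) := by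
      rw [← hvm]; exact norm_sq_toVec _ _
    have hs1' : ((sNum i : ℝ) / sDen) ^ 2 ≤ s ^ 2 := pow_le_pow_left₀ hδ0.le hs1 2
    have e1 : (sNum i : ℝ) ^ 2 ≤ s ^ 2 * (sDen : ℝ) ^ 2 := by
      rw [div_pow, div_le_iff₀ (pow_pos hDpos 2)] at hs1'; exact hs1'
    have hRsq : (10 * (sNum i : ℝ) / sNum (i + 1)) ^ 2 ≤ ‖scaledIntPoint (s / 2) v‖ ^ 2 := by
      rw [hnsq, ht2, div_pow, div_le_iff₀ (pow_pos hhi 2)]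
      nlinarith [mul_le_mul_of_nonneg_left hfarR (sq_nonneg s)]
    exact (pow_le_pow_iff_left₀ hR0 (norm_nonneg _) two_ne_zero).mp hRsq
  have hA := sum_phiT_sub_env_le_two_mul_rootEnergy hδ0 hsep (zero_mem_a15Template hrf s) _ hWS h0W hfar hR1 hRδ
  have hsumW : ∑ z ∈ (a15Win r i).image (fun m => scaledIntPoint (s / 2) (toVec m)), phiT (‖z‖ ^ 2) =
      ∑ m ∈ a15Win r i, phiT (s ^ 2 * ((nsq m).toNat : ℝ) / 4) := by
    rw [Finset.sum_image fun m _ m' _ h => hfinj h]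
    refine Finset.sum_congr rfl fun m _ => ?_
    rw [norm_sq_toVec, ht2]
    have hc : ((nsq m).toNat : ℝ) = (nsq m : ℝ) := by
      have h := Int.toNat_of_nonneg (nsq_nonneg m)
      exact_mod_cast h
    rw [hc]; ring_nf
  have hcovW : ∀ m ∈ a15Win r i, ∃ Dm ∈ H, sNum (i + 1) * sNum (i + 1) * (Dm.1 : ℤ) < 100 * (4 * sDen * sDen) ∧ (nsq m).toNat = Dm.1 := by
    intro m hm
    obtain ⟨hbox, hin⟩ := Finset.mem_filter.mp hm
    have hlt : nsq m < 575 := nsq_lt_of_inside_A15 hin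
    obtain ⟨Dm, hDm, hkey⟩ := List.mem_map.mp (hcov m hbox hlt)
    refine ⟨Dm, hDm, ?_, hkey.symm⟩
    have hD : (Dm.1 : ℤ) = nsq m := by rw [hkey]; exact Int.toNat_of_nonneg (nsq_nonneg m)
    rw [hD]; exact hin
  have hfibW : ∀ Dm ∈ H, sNum (i + 1) * sNum (i + 1) * (Dm.1 : ℤ) < 100 * (4 * sDen * sDen) →
      ((a15Win r i).filter fun m => (nsq m).toNat = Dm.1).card = Dm.2 := by
    intro Dm hDm hP
    have hEq : ((a15Win r i).filter fun m => (nsq m).toNat = Dm.1) = (a15Box r).filter fun m => nsq m = (Dm.1 : ℤ) := by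
      ext m
      simp only [a15Win, Finset.mem_filter]
      constructor
      · rintro ⟨⟨hb, -⟩, hk⟩
        exact ⟨hb, by rw [← hk]; exact (Int.toNat_of_nonneg (nsq_nonneg m)).symm⟩
      · rintro ⟨hb, hk⟩
        refine ⟨⟨hb, by rw [hk]; exact hP⟩, by rw [hk]; exact Int.toNat_natCast Dm.1⟩
    rw [hEq]; exact hfib Dm hDm
  have hreg := sum_key_eq_histogram (fun m : ℤ × ℤ × ℤ => (nsq m).toNat) (fun D : ℕ => phiT (s ^ 2 * (D : ℝ) / 4))
    (fun D : ℕ => sNum (i + 1) * sNum (i + 1) * (D : ℤ) < 100 * (4 * sDen * sDen)) H hnd (a15Win r i) hcovW hfibW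
  rw [hreg] at hsumW
  rw [hsumW] at hA
  exact hA

/-! ## §3 ★ The A15 floors with the transfer -/

/-- the class-X root is a frame point. -/
theorem inFrame_rX : inFrame rX = true := by decide

/-- the class-Y root is a frame point. -/
theorem inFrame_rY : inFrame rY = true := by decide

/-- ★★★ **DROWS-SOUND, A15 — UNCONDITIONAL.**  For every leaf `i < 128` and every nearest-neighbour distance `s ∈ [sNum i/sDen, sNum (i+1)/sDen]`
(`s/s⋆ ∈ [0.94, 1.06]`, `s⋆ = 0.88753`) there is a transfer `t ≥ 0` such that
`e⋆ + 27/1000 − 12·t ≤ rootEnergy V_LJ (count⌊a15Template rX s)` (class-X root) and `e⋆ + 27/1000 + 4·t ≤ rootEnergy V_LJ (count⌊a15Template rY s)` (class-Y root):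
the perfect A15 template, read through census's transfer rule, is not a Lennard-Jones minimiser on its scale window. [this route] -/
theorem a15_rootEnergy_floors {i : ℕ} (hi : i < 128) {s : ℝ} (hs1 : (sNum i : ℝ) / sDen ≤ s) (hs2 : s ≤ (sNum (i + 1) : ℝ) / sDen) :
    ∃ t : ℝ, 0 ≤ t ∧
      eStar + 27 / 1000 - 12 * t ≤ rootEnergy lennardJones (Measure.count.restrict (a15Template rX s) : Measure E3) ∧
      eStar + 27 / 1000 + 4 * t ≤ rootEnergy lennardJones (Measure.count.restrict (a15Template rY s) : Measure E3) := by
  obtain ⟨t, ht0, hX, hY⟩ := drows_A15_sound hi hs1 hs2 rfl rfl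
  have hWX := window_floor inFrame_rX nodup_H0 cover_X fibres_X hi hs1
  have hWY := window_floor inFrame_rY nodup_H1_A15 cover_Y fibres_Y hi hs1
  exact ⟨t, ht0, by linarith, by linarith⟩

end Summit.AtomisticToContinuum.Crystallization.Theorems.FrustratedLawDichotomyDRowsA15Floor
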